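import Summits.Ventures.QEC.Thresholds.ToricCodeThresholdUnconditional
import Mathlib.Analysis.SpecificLimits.Normed
import Mathlib.Analysis.Asymptotics.Lemmas
import HarnessLib

/-!
# Below threshold the toric-code failure probability DECAYS EXPONENTIALLY in `L` (unconditional)

Venture QEC, `Summits/Ventures/QEC/Thresholds/` (LADDER-QEC rung Q5, certified column; PARTITION
row 09). Dennis–Kitaev–Landahl–Preskill: "Not only does eq. (fail_iso) establish a lower bound on
the accuracy threshold; it also shows that, below threshold, the failure probability decreases
exponentially with `L`" (§5.3), typed in `CodeCapacityNoise.lean` as `DecaysExponentially P p`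
(`∃ C, ∃ r ∈ [0,1), ∀ L, |P L p| ≤ C r^L`) — a STRONGER conclusion than `BelowThreshold`
(`P L p → 0`), so far instantiated nowhere. This theorem-only file (kernel axioms, no named-fact
hypothesis, nothing re-asserted) proves it for the toric codes under minimum-weight decoding and
independent bit flips with perfect syndrome measurement, on BOTH certified routes:

* `decaysExponentially_of_eventually_abs_le` — the generic step: a bound `A (L+1)^k r^L`
  (`0 ≤ r < 1`) from some size on is exponential decay (polynomial prefactors are absorbed into any
  rate `r < r₂ < 1`; finitely many small sizes into the constant) — via Mathlib's
  `isLittleO_pow_const_mul_const_pow_const_pow_of_norm_lt` and `bound_of_isBigO_nat_atTop`;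
* `toric_decaysExponentially_sawCountBound` — DKLP route, parametric: under `cₙ ≤ C νⁿ` (`ν ≥ 1`),
  every `0 ≤ p < p₀(ν)` (from the finite-size theorem `toric_failureProb_le`, valid for `L ≥ 3`);
  instances `toric_decaysExponentially_three` (`p < (3-2√2)/6 ≈ .0286`),
  `toric_decaysExponentially_nuMemFour` (`p < p₀(26^{1/3})`), `toric_decaysExponentially_0293`;
* `toric_decaysExponentially_cluster` — cluster route: every `0 ≤ p < 1/5184` (from
  `toric_failureProb_le_cluster`, valid at every size);
* the canonical minimum-weight decoders `Decoder.minWeight` as a non-vacuity instance.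

No decay RATE is certified beyond "some `r < 1`" (DKLP's `(4μ₂²p̃)^{L/2}` shape is visible in the
finite-size theorems themselves). No Monte Carlo number appears here.

## References

* [DennisEtAl2002] E. Dennis, A. Kitaev, A. Landahl, J. Preskill, *Topological quantum memory*,
  J. Math. Phys. 43 (2002) 4452–4505, arXiv:quant-ph/0110143, §5.3 eqs. (fail_iso), (fail_2d) and
  the sentence after eq. (fail_iso).
* [Gottesman2014] D. Gottesman, Quantum Inf. Comput. 14 (2014) 1338, §4 Thm. 3.
-/

noncomputable section

namespace Summit.Ventures.QEC.Thresholds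

open Filter Topology Asymptotics
open Literature.InformationTheory.QuantumCodes
open Literature.InformationTheory.QuantumCodes.ToricCode
open Literature.Probability.RandomPlanarGeometry

/-! ### Generic: polynomial × geometric bounds are exponential decay -/

/-- A family that is `O(r^L)` along `L → ∞` for some `0 < r < 1` decays exponentially (on `ℕ` a
big-O bound with a nowhere-vanishing comparison function holds with a GLOBAL constant).
[cite: DennisEtAl2002, §5.3 (after eq. (fail_iso))] -/
theorem decaysExponentially_of_isBigO {P : ℕ → ℝ → ℝ} {p r : ℝ} (hr₀ : 0 < r) (hr₁ : r < 1)
    (h : (fun L : ℕ => P L p) =O[atTop] fun L : ℕ => r ^ L) : DecaysExponentially P p := by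
  obtain ⟨C, _, hC⟩ := bound_of_isBigO_nat_atTop h
  refine ⟨C, r, hr₀.le, hr₁, fun L => ?_⟩
  have hb := hC (pow_ne_zero L hr₀.ne')
  rwa [Real.norm_eq_abs, Real.norm_eq_abs, abs_of_nonneg (pow_nonneg hr₀.le L)] at hb

/-- **Polynomial prefactors do not spoil exponential decay**: if `|P L p| ≤ A (L+1)^k r^L` for all
large `L`, with `0 ≤ r < 1`, then `P` decays exponentially at `p` (with any rate in `(r, 1)`; DKLP:
"`Q₃(L,T)` is a polynomial … the failure probability decreases exponentially with `L`").
[cite: DennisEtAl2002, §5.3 (eq. (fail_iso) and the sentence after it)] -/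
theorem decaysExponentially_of_eventually_abs_le {P : ℕ → ℝ → ℝ} {p A r : ℝ} {k : ℕ}
    (hr₀ : 0 ≤ r) (hr₁ : r < 1)
    (h : ∀ᶠ L : ℕ in atTop, |P L p| ≤ A * ((L : ℝ) + 1) ^ k * r ^ L) :
    DecaysExponentially P p := by
  set r₂ : ℝ := (1 + r) / 2 with hr₂
  have hrr₂ : r < r₂ := by rw [hr₂]; linarith
  have hr₂1 : r₂ < 1 := by rw [hr₂]; linarith
  have hr₂0 : 0 < r₂ := lt_of_le_of_lt hr₀ hrr₂
  -- `P = O((L+1)^k r^L)`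
  have h0 : (fun L : ℕ => P L p) =O[atTop] fun L : ℕ => ((L : ℝ) + 1) ^ k * r ^ L := by
    refine IsBigO.of_bound |A| (h.mono fun L hL => ?_)
    rw [Real.norm_eq_abs, Real.norm_eq_abs,
      abs_of_nonneg (show (0 : ℝ) ≤ ((L : ℝ) + 1) ^ k * r ^ L by positivity)]
    calc |P L p| ≤ A * ((L : ℝ) + 1) ^ k * r ^ L := hL
      _ = A * (((L : ℝ) + 1) ^ k * r ^ L) := by ring
      _ ≤ |A| * (((L : ℝ) + 1) ^ k * r ^ L) :=
          mul_le_mul_of_nonneg_right (le_abs_self A) (by positivity)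
  -- `(L+1)^k r^L = O(L^k r^L)` (sizes `L ≥ 1`)
  have h1 : (fun L : ℕ => ((L : ℝ) + 1) ^ k * r ^ L) =O[atTop] fun L : ℕ => (L : ℝ) ^ k * r ^ L := by
    refine IsBigO.of_bound ((2 : ℝ) ^ k) ?_
    rw [eventually_atTop]
    refine ⟨1, fun L hL => ?_⟩
    rw [Real.norm_eq_abs, Real.norm_eq_abs, abs_of_nonneg (by positivity),
      abs_of_nonneg (by positivity)]
    have hL1 : (1 : ℝ) ≤ L := by exact_mod_cast hL
    have hL2 : (L : ℝ) + 1 ≤ 2 * L := by linarith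
    calc ((L : ℝ) + 1) ^ k * r ^ L ≤ (2 * (L : ℝ)) ^ k * r ^ L := by gcongr
      _ = 2 ^ k * ((L : ℝ) ^ k * r ^ L) := by rw [mul_pow]; ring
  -- `L^k r^L = o(r₂^L)`
  have h2 : (fun L : ℕ => (L : ℝ) ^ k * r ^ L) =o[atTop] fun L : ℕ => r₂ ^ L :=
    isLittleO_pow_const_mul_const_pow_const_pow_of_norm_lt k
      (by rwa [Real.norm_eq_abs, abs_of_nonneg hr₀])
  exact decaysExponentially_of_isBigO hr₂0 hr₂1 ((h0.trans h1).trans_isLittleO h2).isBigO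

/-! ### Route 1 (DKLP): exponential decay below `p₀(ν)` -/

/-- **Exponential decay below threshold, DKLP route, parametric and unconditional**: under
`cₙ ≤ C νⁿ` (`ν ≥ 1`), for every minimum-weight decoder family and every `0 ≤ p < p₀(ν)`, the
failure probability of the `(L+1) × (L+1)` toric codes satisfies `Prob_fail(L) ≤ C' r'^L` for some
`C'` and `r' < 1` (from the finite-size bound `2L²C r^L/(ν(1-r))`, `r = 2ν√(p(1-p)) < 1`).
tier CERTIFIED (kernel). [cite: DennisEtAl2002, §5.3 eq. (fail_2d) and the sentence after eq. (fail_iso)] -/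
theorem toric_decaysExponentially_sawCountBound {C ν : ℝ} (hν : 1 ≤ ν) (hc : SAWCountBound C ν)
    {D : (L : ℕ) → ZDecoder (L + 1)}
    (hD : ∀ L, (D L).IsMinWeight (syn (L + 1)) (cycles (L + 1)) hammingNorm) {p : ℝ}
    (hp₀ : 0 ≤ p) (hpp : p < thresholdValue ν) :
    DecaysExponentially (toricFailureFamily D) p := by
  -- `p < p₀(ν)` ⟹ `r = 2ν√(p(1-p)) < 1`
  have hp : p ≤ 1 / 2 := hpp.le.trans (thresholdValue_le_half ν)
  have hlt : p * (1 - p) < thresholdValue ν * (1 - thresholdValue ν) :=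
    mul_one_sub_lt_mul_one_sub hpp (by linarith [thresholdValue_le_half ν])
  have hν0 : 0 < ν := lt_of_lt_of_le one_pos hν
  have h4 : 4 * ν ^ 2 * (p * (1 - p)) < 1 := by
    calc 4 * ν ^ 2 * (p * (1 - p)) < 4 * ν ^ 2 * (thresholdValue ν * (1 - thresholdValue ν)) := by
          gcongr
      _ = 1 := four_mul_sq_mul_thresholdValue hν
  set s := Real.sqrt (p * (1 - p)) with hs
  set r := 2 * ν * s with hr
  have hpp' : 0 ≤ p * (1 - p) := mul_nonneg hp₀ (by linarith)
  have hr0 : 0 ≤ r := by rw [hr]; positivity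
  have hr1 : r < 1 := by
    have hsq : r ^ 2 = 4 * ν ^ 2 * (p * (1 - p)) := by
      rw [hr, mul_pow, mul_pow, hs, Real.sq_sqrt hpp']; ring
    have h' : r ^ 2 < 1 := by rw [hsq]; exact h4
    have := (sq_lt_one_iff_abs_lt_one r).1 h'
    rwa [abs_of_nonneg hr0] at this
  have h1r : 0 < 1 - r := by linarith
  -- the finite-size bound from size `L + 1 ≥ 3` on, in the shape `A (L+1)² r^L`
  refine decaysExponentially_of_eventually_abs_le (A := 2 * C * r / (ν * (1 - r))) (k := 2) hr0 hr1 ?_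
  rw [eventually_atTop]
  refine ⟨2, fun L hL => ?_⟩
  have hnonneg : 0 ≤ toricFailureFamily D L p := by
    simp only [toricFailureFamily, failureProb]
    exact Finset.sum_nonneg fun e _ => bernoulliWeight_nonneg hp₀ (by linarith) _
  rw [abs_of_nonneg hnonneg]
  have hb := toric_failureProb_le hν0 hc (L + 1) (by omega) (hD L) hp₀ hp hr1
  simp only [toricFailureFamily]
  calc failureProb (L + 1) (D L) p
      ≤ 2 * ((L + 1 : ℕ) : ℝ) ^ 2 * C * r ^ (L + 1) / (ν * (1 - r)) := hb
    _ = 2 * C * r / (ν * (1 - r)) * ((L : ℝ) + 1) ^ 2 * r ^ L := by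
        push_cast
        rw [pow_succ]
        field_simp
        ring

/-- **Exponential decay for every `0 ≤ p < (3 - 2√2)/6 ≈ .0286`** (DKLP's elementary walk count),
for every minimum-weight decoder family; unconditional, tier CERTIFIED (kernel).
[cite: DennisEtAl2002, §5.3 eqs. (saw_d), (fail_2d)] -/
theorem toric_decaysExponentially_three {D : (L : ℕ) → ZDecoder (L + 1)}
    (hD : ∀ L, (D L).IsMinWeight (syn (L + 1)) (cycles (L + 1)) hammingNorm) {p : ℝ}
    (hp₀ : 0 ≤ p) (hpp : p < (3 - 2 * Real.sqrt 2) / 6) :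
    DecaysExponentially (toricFailureFamily D) p :=
  toric_decaysExponentially_sawCountBound (by norm_num) sawCountBound_three hD hp₀
    (by rwa [thresholdValue_three])

/-- **Exponential decay for every `0 ≤ p < p₀(26^{1/3})`** (memory-4 walk count), for every
minimum-weight decoder family; unconditional, tier CERTIFIED (kernel).
[cite: DennisEtAl2002, §5.3 eq. (fail_2d)] -/
theorem toric_decaysExponentially_nuMemFour {D : (L : ℕ) → ZDecoder (L + 1)}
    (hD : ∀ L, (D L).IsMinWeight (syn (L + 1)) (cycles (L + 1)) hammingNorm) {p : ℝ}
    (hp₀ : 0 ≤ p) (hpp : p < thresholdValue nuMemFour) :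
    DecaysExponentially (toricFailureFamily D) p :=
  toric_decaysExponentially_sawCountBound (le_trans (by norm_num) nuMemFour_ge)
    sawCountBound_memoryFour hD hp₀ hpp

/-- Decimal form: **exponential decay for every `0 ≤ p ≤ .0293`**, for every minimum-weight
decoder family; unconditional, tier CERTIFIED (kernel). [cite: DennisEtAl2002, §5.3 eq. (fail_2d)] -/
theorem toric_decaysExponentially_0293 {D : (L : ℕ) → ZDecoder (L + 1)}
    (hD : ∀ L, (D L).IsMinWeight (syn (L + 1)) (cycles (L + 1)) hammingNorm) {p : ℝ}
    (hp₀ : 0 ≤ p) (hpp : p ≤ 0.0293) :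
    DecaysExponentially (toricFailureFamily D) p :=
  toric_decaysExponentially_nuMemFour hD hp₀ (lt_of_le_of_lt hpp thresholdValue_nuMemFour_gt)

/-! ### Route 2 (cluster counting): exponential decay below `1/5184` -/

/-- **Exponential decay for every `0 ≤ p < 1/(4·6⁴) = 1/5184` by the cluster route**, for every
minimum-weight decoder family (finite-size bound `2L² r^L/(36(1-r))`, `r = 72√p`, at every size);
unconditional, tier CERTIFIED (kernel). [cite: Gottesman2014, Thm 3 (n (p/p₀)^{d/2})] -/
theorem toric_decaysExponentially_cluster {D : (L : ℕ) → ZDecoder (L + 1)}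
    (hD : ∀ L, (D L).IsMinWeight (syn (L + 1)) (cycles (L + 1)) hammingNorm) {p : ℝ}
    (hp₀ : 0 ≤ p) (hpp : p < 1 / (4 * (6 : ℝ) ^ 4)) :
    DecaysExponentially (toricFailureFamily D) p := by
  have hp₁ : p ≤ 1 := by
    have : 1 / (4 * (6 : ℝ) ^ 4) ≤ 1 := by norm_num
    linarith
  have hr1 : 2 * (6 : ℝ) ^ 2 * Real.sqrt p < 1 := by
    have := two_mul_sq_mul_sqrt_lt_one (Δ := 6) (by norm_num) (p := p) (by exact_mod_cast hpp)
    exact_mod_cast this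
  set r : ℝ := 2 * (6 : ℝ) ^ 2 * Real.sqrt p with hr
  have hr0 : 0 ≤ r := by positivity
  have h1r : 0 < 1 - r := by linarith
  refine decaysExponentially_of_eventually_abs_le (A := 2 * r / ((6 : ℝ) ^ 2 * (1 - r))) (k := 2)
    hr0 hr1 (Filter.Eventually.of_forall fun L => ?_)
  have hnonneg : 0 ≤ toricFailureFamily D L p := by
    simp only [toricFailureFamily, failureProb]
    exact Finset.sum_nonneg fun e _ => bernoulliWeight_nonneg hp₀ hp₁ _
  rw [abs_of_nonneg hnonneg]
  have hb := toric_failureProb_le_cluster (L + 1) (by omega) (hD L) hp₀ hp₁ hr1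
  simp only [toricFailureFamily]
  calc failureProb (L + 1) (D L) p
      ≤ (2 * ((L + 1 : ℕ) : ℝ) ^ 2) * r ^ (L + 1) / ((6 : ℝ) ^ 2 * (1 - r)) := hb
    _ = 2 * r / ((6 : ℝ) ^ 2 * (1 - r)) * ((L : ℝ) + 1) ^ 2 * r ^ L := by
        push_cast
        rw [pow_succ]
        field_simp
        ring

/-! ### Non-vacuity: the canonical minimum-weight decoders -/

/-- The canonical minimum-weight decoders `Decoder.minWeight` of the toric codes have
exponentially decaying failure probability at every `0 ≤ p ≤ .0293` (unconditional, kernel).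
[cite: DennisEtAl2002, §5.3 (after eq. (fail_iso))] -/
theorem ToricCode.decaysExponentially_minWeight {p : ℝ} (hp₀ : 0 ≤ p) (hpp : p ≤ 0.0293) :
    DecaysExponentially (toricFailureFamily fun L => Decoder.minWeight (syn (L + 1)) hammingNorm) p :=
  toric_decaysExponentially_0293 (fun L => ToricCode.isMinWeight_minWeight (L + 1)) hp₀ hpp

end Summit.Ventures.QEC.Thresholds

end
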